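import Literature.MathematicalPhysics.QuantumLattice.HubbardFermionInteractionTerms
import HarnessLib

/-!
# The local Hamiltonians of the Hubbard interaction are the Hubbard Hamiltonians of the boxes

Topic `Literature/MathematicalPhysics/QuantumLattice`; namespace
`Literature.MathematicalPhysics.QuantumLattice` (the file path). Companion of
`InfVolFermionState.lean` §6 and `HubbardFermionInteractionTerms.lean`: for every finite region
`Λ ⊆ ℤ^d`, the local Hamiltonian `H_Λ = Σ_{X ⊆ Λ} Φ(X)` (free boundary conditions,
`FermionInteraction.localHamiltonian`) of the Hubbard interaction `hubbardFermionInteraction d t U`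
IS the tree's graph Hubbard Hamiltonian `hamiltonian (polyGraph Λ) t U` of the induced
nearest-neighbour graph on the sites of `Λ` (`polyGraph`, `HubbardLatticeActivity.lean`). Hence all
of the finite-graph theory (Hermiticity, particle-number conservation, sector ground-state energies
`groundEnergyAt (polyGraph Λ) t U N`, a priori bounds, cut/subadditivity lemmas) applies to the
local Hamiltonians of the infinite-volume formalism. Everything is PROVED; no definition, no named
fact.

## Results

* `FermionInteraction.localHamiltonian_eq_sum`: for ANY interaction, `H_Λ` as a plain sum over the
  subsets of `Λ` (the `attach` of the definition removed).
* `sum_powerset_eq_of_hubbard_support`: a sum over `X ⊆ Λ` of a function vanishing off the support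
  of the Hubbard interaction splits into the sum over the sites and the sum over the bonds of `Λ`.
* `hubbardFermionInteraction_localHamiltonian`: `H_Λ = hamiltonian (polyGraph Λ) t U`.

Hubbard (1963); Lieb, arXiv:cond-mat/9311033 §2; Araki–Moriya (2003) §5.1 (`H(I) = Σ_{K⊆I} Φ(K)`).
-/

noncomputable section

namespace Literature.MathematicalPhysics.QuantumLattice

open Matrix Finset HubbardWave0 Literature.Probability.LatticeModels

variable {d : ℕ}

/-! ### Sums over the subsets of a region supported on sites and bonds -/

/-- The local Hamiltonian as a plain sum over subsets (the `attach` of the definition removed):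
`H_Λ = Σ_{X ⊆ Λ} Γ(X ⊆ Λ)(Φ X)`, the embedding chosen through `dite`.
[cite: ArakiMoriya2003, §5.1 (local Hamiltonian H(I))] -/
theorem FermionInteraction.localHamiltonian_eq_sum (Ψ : FermionInteraction d) (Λ : Finset (Site d)) :
    Ψ.localHamiltonian Λ =
      ∑ X ∈ Λ.powerset, if h : X ⊆ Λ then fermionEmbed (PolySite.incl h) (Ψ.Φ X) else 0 := by
  rw [FermionInteraction.localHamiltonian, ← Finset.sum_attach Λ.powerset]
  refine Finset.sum_congr rfl fun X _ => ?_
  rw [dif_pos (Finset.mem_powerset.1 X.2)]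

/-- **Support of the Hubbard interaction inside a region.** If `F : Finset (Site d) → M` vanishes on
every `X` which is neither a singleton nor a nearest-neighbour pair `{x, x + e_i}`, then
`Σ_{X ⊆ Λ} F X = Σ_{x ∈ Λ} F {x} + Σ_{x ∈ Λ, i : x + e_i ∈ Λ} F {x, x + e_i}`. [folklore] -/
theorem sum_powerset_eq_of_hubbard_support {M : Type*} [AddCommMonoid M] (Λ : Finset (Site d))
    (F : Finset (Site d) → M)
    (hF : ∀ X : Finset (Site d), (∀ x : Site d, X ≠ {x}) → (∀ (x : Site d) (i : Fin d), X ≠ {x, x + unitVec i}) →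
      F X = 0) :
    ∑ X ∈ Λ.powerset, F X =
      ∑ x ∈ Λ, F {x} +
        ∑ p ∈ (Λ ×ˢ (univ : Finset (Fin d))) with p.1 + unitVec p.2 ∈ Λ, F {p.1, p.1 + unitVec p.2} := by
  classical
  set P : Finset (Site d × Fin d) := (Λ ×ˢ (univ : Finset (Fin d))).filter fun p => p.1 + unitVec p.2 ∈ Λ
    with hP
  set S' : Finset (Finset (Site d)) :=
    Λ.image (fun x => ({x} : Finset (Site d))) ∪ P.image fun p => ({p.1, p.1 + unitVec p.2} : Finset (Site d))
    with hS'
  have hS'sub : S' ⊆ Λ.powerset := by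
    intro X hX
    rw [hS', mem_union, mem_image, mem_image] at hX
    rw [mem_powerset]
    rcases hX with ⟨x, hx, rfl⟩ | ⟨p, hp, rfl⟩
    · exact singleton_subset_iff.2 hx
    · rw [hP, mem_filter, mem_product] at hp
      exact insert_subset hp.1.1 (singleton_subset_iff.2 hp.2)
  have hzero : ∀ X ∈ Λ.powerset, X ∉ S' → F X = 0 := by
    intro X hX hXS
    rw [mem_powerset] at hX
    refine hF X (fun x hx => hXS ?_) (fun x i hx => hXS ?_)
    · rw [hS', mem_union, mem_image]
      exact Or.inl ⟨x, hX (hx ▸ mem_singleton_self x), hx.symm⟩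
    · rw [hS', mem_union, mem_image, mem_image]
      refine Or.inr ⟨(x, i), ?_, hx.symm⟩
      rw [hP, mem_filter, mem_product]
      exact ⟨⟨hX (hx ▸ mem_insert_self _ _), mem_univ _⟩, hX (hx ▸ mem_insert_of_mem (mem_singleton_self _))⟩
  rw [← Finset.sum_subset hS'sub hzero]
  have hdisj : Disjoint (Λ.image fun x => ({x} : Finset (Site d)))
      (P.image fun p => ({p.1, p.1 + unitVec p.2} : Finset (Site d))) := by
    rw [disjoint_iff_ne]
    rintro X hX Y hY rfl
    rw [mem_image] at hX hY
    obtain ⟨x, -, rfl⟩ := hX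
    obtain ⟨p, -, hp⟩ := hY
    have := congrArg Finset.card hp
    rw [card_pair (self_ne_add_unitVec p.1 p.2), card_singleton] at this
    exact absurd this (by norm_num)
  have hinj1 : Set.InjOn (fun x => ({x} : Finset (Site d))) ↑Λ := fun x _ y _ h => singleton_injective h
  have hinj2 : Set.InjOn (fun p : Site d × Fin d => ({p.1, p.1 + unitVec p.2} : Finset (Site d))) ↑P := by
    rintro ⟨x, i⟩ - ⟨y, j⟩ - h
    dsimp only at h
    have hx : x ∈ ({y, y + unitVec j} : Finset (Site d)) := h ▸ mem_insert_self _ _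
    have hxi : x + unitVec i ∈ ({y, y + unitVec j} : Finset (Site d)) := h ▸ mem_insert_of_mem (mem_singleton_self _)
    rw [mem_insert, mem_singleton] at hx hxi
    rcases hx with rfl | rfl
    · rcases hxi with h' | h'
      · exact absurd h' (self_ne_add_unitVec x i).symm
      · rw [Prod.mk.injEq]
        exact ⟨rfl, uvec_injective (add_left_cancel h')⟩
    · rcases hxi with h' | h'
      · exact absurd h' (add_unitVec_add_unitVec_ne_self y j i)
      · exact absurd (add_eq_left.1 h') (uvec_ne_zero i)
  rw [hS', Finset.sum_union hdisj, Finset.sum_image hinj1, Finset.sum_image hinj2]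

/-! ### The local Hamiltonian of the Hubbard interaction -/

section LocalHamiltonian

variable (t U : ℝ)

/-- A sum over the sites of `Λ` (`Λ.attach`) of an indicator of one site is the value there (or `0`).
[folklore] -/
theorem sum_attach_ite_eq {M : Type*} [AddCommMonoid M] (Λ : Finset (Site d)) (z : Site d)
    (g : {x // x ∈ Λ} → M) :
    ∑ y ∈ Λ.attach, (if (y.1 = z) then g y else 0) = if h : z ∈ Λ then g ⟨z, h⟩ else 0 := by
  classical
  by_cases hz : z ∈ Λ
  · rw [dif_pos hz, Finset.sum_eq_single ⟨z, hz⟩]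
    · rw [if_pos rfl]
    · rintro ⟨y, hy⟩ - hne
      exact if_neg fun h => hne (Subtype.ext h)
    · intro h
      exact absurd (mem_attach _ _) h
  · rw [dif_neg hz]
    refine Finset.sum_eq_zero ?_
    rintro ⟨y, hy⟩ -
    exact if_neg fun h => by subst h; exact hz hy

/-- Adjacency in `ℤ^d`, as an indicator, splits over the `2d` directions: for a function `T`,
`[x ~ y] T = Σ_i ([y = x + e_i] T + [x = y + e_i] T)` (exactly one of the `2d` conditions holds
when `x ~ y`, none otherwise). [folklore] -/
theorem ite_zdGraph_adj_eq_sum {M : Type*} [AddCommMonoid M] (x y : Site d) (T : M) :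
    (if (zdGraph d).Adj x y then T else 0) =
      ∑ i : Fin d, ((if y = x + unitVec i then T else 0) + (if x = y + unitVec i then T else 0)) := by
  classical
  by_cases h : (zdGraph d).Adj x y
  · rw [if_pos h]
    obtain ⟨i, hi⟩ := (zdGraph_adj_iff x y).1 h
    rw [Finset.sum_eq_single i]
    · rcases hi with rfl | rfl
      · rw [if_pos rfl, if_neg (add_unitVec_add_unitVec_ne_self x i i).symm, add_zero]
      · rw [if_neg (add_unitVec_add_unitVec_ne_self y i i).symm, if_pos rfl, zero_add]
    · intro j _ hji
      rcases hi with rfl | rfl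
      · rw [if_neg, if_neg (add_unitVec_add_unitVec_ne_self x i j).symm, add_zero]
        intro h'
        exact hji (uvec_injective (add_left_cancel h')).symm
      · rw [if_neg (add_unitVec_add_unitVec_ne_self y i j).symm, if_neg, add_zero]
        intro h'
        exact hji (uvec_injective (add_left_cancel h')).symm
    · intro hi'
      exact absurd (mem_univ i) hi'
  · rw [if_neg h]
    refine (Finset.sum_eq_zero fun i _ => ?_).symm
    rw [if_neg, if_neg, add_zero]
    · exact fun h' => h ((zdGraph_adj_iff x y).2 ⟨i, Or.inr h'⟩)
    · exact fun h' => h ((zdGraph_adj_iff x y).2 ⟨i, Or.inl h'⟩)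

/-- **The local Hamiltonian of the Hubbard interaction is the Hubbard Hamiltonian of the induced
graph**: `Σ_{X ⊆ Λ} Φ(X) = hamiltonian (polyGraph Λ) t U` — on-site repulsion at every site of
`Λ` and hopping along every nearest-neighbour bond inside `Λ` (free boundary conditions).
[cite: arXiv9311033, §2 (the Hubbard Hamiltonian)] -/
theorem hubbardFermionInteraction_localHamiltonian (Λ : Finset (Site d)) :
    (hubbardFermionInteraction d t U).localHamiltonian Λ = hamiltonian (polyGraph Λ) t U := by
  classical
  -- the two building blocks, indexed by the sites of `Λ`
  set nn : {x // x ∈ Λ} → FermionOp Λ := fun x =>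
    numberOp (PolySite.pt x.1 x.2) 0 * numberOp (PolySite.pt x.1 x.2) 1 with hnn
  set hop : {x // x ∈ Λ} → {x // x ∈ Λ} → FermionOp Λ := fun x y =>
    ∑ σ : Fin 2, creation (orb (PolySite.pt x.1 x.2) σ) * annihilation (orb (PolySite.pt y.1 y.2) σ) with hhop
  -- (1) the graph Hamiltonian over `Λ.attach`
  have hR : hamiltonian (polyGraph Λ) t U =
      -(t : ℂ) • ∑ x ∈ Λ.attach, ∑ y ∈ Λ.attach, (if (zdGraph d).Adj x.1 y.1 then hop x y else 0) +
        (U : ℂ) • ∑ x ∈ Λ.attach, nn x := by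
    let e : PolySite Λ ≃ {x // x ∈ Λ} :=
      ⟨fun a => ⟨ofLex a.1, PolySite.ofLex_mem a⟩, fun x => PolySite.pt x.1 x.2, fun a => PolySite.pt_ofLex a,
        fun x => Subtype.ext rfl⟩
    have hsum : ∀ (f : PolySite Λ → FermionOp Λ), ∑ a, f a = ∑ x ∈ Λ.attach, f (PolySite.pt x.1 x.2) := by
      intro f
      rw [← Finset.univ_eq_attach]
      exact Fintype.sum_equiv e f (fun x => f (PolySite.pt x.1 x.2)) fun a => by
        rw [show PolySite.pt (e a).1 (e a).2 = e.symm (e a) from rfl, Equiv.symm_apply_apply]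
    rw [hamiltonian, hsum, hsum]
    congr 2
    refine Finset.sum_congr rfl fun x _ => ?_
    rw [hsum]
    refine Finset.sum_congr rfl fun y _ => ?_
    by_cases h : (zdGraph d).Adj x.1 y.1
    · rw [if_pos h]
      exact Finset.sum_congr rfl fun σ _ => if_pos ((polyGraph_adj _ _).2 h)
    · rw [if_neg h]
      exact Finset.sum_eq_zero fun σ _ => if_neg fun h' => h ((polyGraph_adj _ _).1 h')
  -- (2) the hopping double sum as a sum over the bonds of `Λ`
  have hhopsum : ∑ x ∈ Λ.attach, ∑ y ∈ Λ.attach, (if (zdGraph d).Adj x.1 y.1 then hop x y else 0) =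
      ∑ i : Fin d, ∑ x ∈ Λ.attach,
        if h : x.1 + unitVec i ∈ Λ then hop x ⟨x.1 + unitVec i, h⟩ + hop ⟨x.1 + unitVec i, h⟩ x else 0 := by
    simp_rw [ite_zdGraph_adj_eq_sum]
    have hswap : ∀ x : {x // x ∈ Λ},
        ∑ y ∈ Λ.attach, ∑ i : Fin d, ((if y.1 = x.1 + unitVec i then hop x y else 0) +
            (if x.1 = y.1 + unitVec i then hop x y else 0)) =
          ∑ i : Fin d, ∑ y ∈ Λ.attach, ((if y.1 = x.1 + unitVec i then hop x y else 0) +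
            (if x.1 = y.1 + unitVec i then hop x y else 0)) := fun x => Finset.sum_comm
    simp_rw [hswap]
    rw [Finset.sum_comm]
    refine Finset.sum_congr rfl fun i _ => ?_
    simp only [Finset.sum_add_distrib]
    have h1 : ∀ x : {x // x ∈ Λ}, ∑ y ∈ Λ.attach, (if y.1 = x.1 + unitVec i then hop x y else 0) =
        if h : x.1 + unitVec i ∈ Λ then hop x ⟨x.1 + unitVec i, h⟩ else 0 := fun x =>
      sum_attach_ite_eq Λ (x.1 + unitVec i) (fun y => hop x y)
    have h2 : ∑ x ∈ Λ.attach, ∑ y ∈ Λ.attach, (if x.1 = y.1 + unitVec i then hop x y else 0) =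
        ∑ y ∈ Λ.attach, if h : y.1 + unitVec i ∈ Λ then hop ⟨y.1 + unitVec i, h⟩ y else 0 := by
      rw [Finset.sum_comm]
      exact Finset.sum_congr rfl fun y _ => sum_attach_ite_eq Λ (y.1 + unitVec i) (fun x => hop x y)
    simp_rw [h1]
    rw [h2, ← Finset.sum_add_distrib]
    refine Finset.sum_congr rfl fun x _ => ?_
    by_cases h : x.1 + unitVec i ∈ Λ
    · rw [dif_pos h, dif_pos h, dif_pos h]
    · rw [dif_neg h, dif_neg h, dif_neg h, add_zero]
  -- (3) the local Hamiltonian over sites and bonds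
  rw [FermionInteraction.localHamiltonian_eq_sum,
    sum_powerset_eq_of_hubbard_support Λ _ (fun X h1 h2 => by
      by_cases h : X ⊆ Λ
      · rw [dif_pos h, hubbardFermionInteraction_apply_eq_zero t U h1 h2, map_zero]
      · rw [dif_neg h]),
    hR, hhopsum]
  refine (congrArg₂ (· + ·) ?_ ?_).trans (add_comm _ _)
  · -- on-site terms
    rw [Finset.smul_sum, ← Finset.sum_attach Λ]
    refine Finset.sum_congr rfl fun x _ => ?_
    rw [dif_pos (singleton_subset_iff.2 x.2), hubbardFermionInteraction_apply_singleton, fermionEmbed_smul,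
      fermionEmbed_mul, nAt, nAt, fermionEmbed_numberOp, fermionEmbed_numberOp, PolySite.incl_pt]
  · -- bond terms
    rw [Finset.sum_filter, Finset.sum_product, ← Finset.sum_attach Λ, Finset.sum_comm, Finset.smul_sum]
    refine Finset.sum_congr rfl fun i _ => ?_
    rw [Finset.smul_sum]
    refine Finset.sum_congr rfl fun x _ => ?_
    by_cases h : x.1 + unitVec i ∈ Λ
    · have hsub : ({x.1, x.1 + unitVec i} : Finset (Site d)) ⊆ Λ := insert_subset x.2 (singleton_subset_iff.2 h)
      rw [if_pos h, dif_pos h, dif_pos hsub, hubbardFermionInteraction_apply_pair, fermionEmbed_smul,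
        fermionEmbed_sum, hhop]
      simp only [← Finset.sum_add_distrib]
      congr 1
      refine Finset.sum_congr rfl fun σ _ => ?_
      rw [fermionEmbed_add, fermionEmbed_mul, fermionEmbed_mul, fermionEmbed_conjTranspose,
        fermionEmbed_conjTranspose, fermionEmbed_incl_cAt, fermionEmbed_incl_cAt, cAt, cAt,
        annihilation_conjTranspose, annihilation_conjTranspose]
    · rw [if_neg h, dif_neg h, smul_zero]

end LocalHamiltonian

end Literature.MathematicalPhysics.QuantumLattice

end
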